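import Summits.QuantumFields.BalabanUV.T4Continuum.Support.CTScalarGreenComm
import Summits.QuantumFields.BalabanUV.T4Continuum.Support.ScalarGaugeProjectionUnit

/-!
# T⁴ programme, SUBSTRATE (shared lattice-gauge analysis library) — THE NON-LOCAL PROJECTION TERM `∂·P·∂ᴴ` OF [B5] (1.69) HAS A SMALL
# CONJUGATION DEFECT IN OPERATOR NORM: `‖c(∂P∂ᴴ) − ∂P∂ᴴ‖ ≤ EK(κ)`, `EK = O(κ)`, LEVEL-FREE (programme VEC, file 5, `U = 1`)

Substrate cell `b2b-balaban-substrate-*`, seat p3.  By `ScalarGaugeProjectionUnit.GradOp_Pone_GradOpH_eq` and `Pone_eq_iso` the gauge term of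
`B5DeltaA169.DeltaA` factorises as `∂·PcT·∂ᴴ = X·K⁻¹·Xᴴ` with the BOUNDED factors `X = ∂G′Q̃′ᴴ` (‖X‖ ≤ √(1/γ′)) and the compressed operator
`K = Kcomp = (Q̃′G′)(Q̃′G′)ᴴ` (`σ₀²`-coercive, `ScalarAveragedCompression.form_Kcomp_ge`).  File 4's smallness of `c(∂G′) − ∂G′`, `c(Q̃′G′) − Q̃′G′` (and
adjoints) gives:
 * §1 `gaugeTerm_eq_factor` (`∂·PcT·∂ᴴ = X·Kcomp⁻¹·Xᴴ`), `Kcomp_eq_gram'` (`K = (Q̃′G′)·(G′Q̃′ᴴ)`), the telescoping `triple_sub`;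
 * §2 the factor bounds: `opNorm_Xp_le` (`‖X‖ ≤ BXp`), **`opNorm_conjMat_Xp_sub_le`** (`‖cX − X‖ ≤ EXp`), **`opNorm_conjMat_XpH_sub_le`**,
   **`opNorm_conjMat_Kcomp_sub_le`** (`‖cK − K‖ ≤ deltaK := EQG·(2/γ′ + EQG)`), hence (`CTConjugationPieces.opNorm_conjMat_inv_le ∕ _sub_le` with the
   `σ₀²`-coercivity) `‖cK⁻¹‖ ≤ (σ₀² − deltaK)⁻¹`, `‖cK⁻¹ − K⁻¹‖ ≤ (σ₀² − deltaK)⁻¹·deltaK·σ₀⁻²` when `deltaK < σ₀²`;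
 * §3 **`opNorm_conjMat_gaugeTerm_sub_le`**: `‖conjMat κ ρ_b ρ_b (∂·PcT·∂ᴴ) − ∂·PcT·∂ᴴ‖ ≤ EK d a′ κ Λ` for every site weight `ρ₀` that is `1/n`-Lipschitz with
   block oscillation `≤ Λ` (bond weight `ρ_b = bondW₀ ρ₀`), any `a′ > 0` with `Jfree < γ′` and `deltaK < σ₀²` — the SOURCE-2 input
   (`CTWeightedCoercivity.conjDefect_of_opNorm`) for the vector operator `Δ_a` (file VEC-6).  `EK` vanishes at `κ = 0`.

HONEST FRAMING (T4-DAG p. 1).  `U = 1` lattice linear algebra ([folklore]); the printed (1.126) kernel bound for `∂P∂*` is NEITHER used NOR proved —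
this is an operator-norm (ℓ²) statement; no estimate of any NE row; nothing printed is a hypothesis; no `def … : Prop`; spine 0/9 unchanged; NOT
infinite volume ∕ mass gap ∕ Clay.  HONEST DEPENDENCY: continuum YM on T⁴ ⇐ BetaPertH ∧ nine spine estimates (0/9 proved); BetaPertH ⇐ (D1) ∧ (D4) ∧
CAP+tail; G-an2-4 gates asym, D1 and NE2/3/4.  ABSOLUTE RULE kept; no `sorry`.
-/

noncomputable section

open scoped BigOperators ComplexConjugate Matrix Matrix.Norms.L2Operator ComplexOrder

namespace Summit.QuantumFields.BalabanUV.T4Continuum.CTGaugeTerm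

open Literature.MathematicalPhysics.QuantumFieldTheory.Balaban1983to89.B5Prop11Plancherel (Tor fine unitVec)
open Literature.MathematicalPhysics.QuantumFieldTheory.Balaban1983to89.B5Action121 (GradOp)
open Literature.MathematicalPhysics.QuantumFieldTheory.Balaban1983to89.B5Blocks16 (blockOf)
open Literature.MathematicalPhysics.QuantumFieldTheory.Balaban1983to89.B5Value126 (PcT)
open Summit.QuantumFields.BalabanUV.T4Continuum
open Summit.QuantumFields.BalabanUV.T4Continuum.CoerciveInverseTower (Coercive)
open Summit.QuantumFields.BalabanUV.T4Continuum.ScalarAveragedPropagator (DeltaPs Gps gammaPs gammaPs_pos Gps_isHermitian opNorm_Gps_le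
  opNorm_GradOp_mul_Gps_le)
open Summit.QuantumFields.BalabanUV.T4Continuum.ScalarAveragedCompression (Qiso Kcomp sigma0 sigma0_pos opNorm_Qiso_le Kcomp_eq_iso form_Kcomp_ge
  opNorm_Kcomp_inv_le)
open Summit.QuantumFields.BalabanUV.T4Continuum.ScalarGaugeProjectionUnit (Pone Pone_eq_iso GradOp_Pone_GradOpH_eq)
open Summit.QuantumFields.BalabanUV.T4Continuum.CTWeightedCoercivity
open Summit.QuantumFields.BalabanUV.T4Continuum.CTConjugationPieces
open Summit.QuantumFields.BalabanUV.T4Continuum.CTConjugationTorus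
open Summit.QuantumFields.BalabanUV.T4Continuum.CTScalarGreen
open Summit.QuantumFields.BalabanUV.T4Continuum.CTScalarGreenComm

variable {d : ℕ} (n : ℕ) [NeZero n] (M : Fin d → ℕ) [hM : ∀ μ, NeZero (M μ)]
variable {ρ₀ : Tor (fine n M) → ℝ} {κ a' Λ : ℝ}

/-! ## §1 The factorisation of the gauge term -/

/-- the bounded left factor `X = ∂·G′·Q̃′ᴴ`. [folklore] -/
def Xp (a' : ℝ) : Matrix (Tor (fine n M) × Fin d) (Tor M) ℂ := GradOp (fine n M) ((n : ℕ) : ℂ) * Gps n M a' * (Qiso n M)ᴴ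

/-- `Xᴴ = Q̃′·G′·∂ᴴ`. [folklore] -/
theorem Xp_conjTranspose (a' : ℝ) : (Xp n M a')ᴴ = Qiso n M * Gps n M a' * (GradOp (fine n M) ((n : ℕ) : ℂ))ᴴ := by
  rw [Xp, Matrix.conjTranspose_mul, Matrix.conjTranspose_mul, Matrix.conjTranspose_conjTranspose, (Gps_isHermitian n M a').eq, Matrix.mul_assoc]

/-- **`∂·PcT·∂ᴴ = X·Kcomp⁻¹·Xᴴ`** (`GradOp_Pone_GradOpH_eq` + `Pone_eq_iso`). [folklore] -/
theorem gaugeTerm_eq_factor (ha' : 0 < a') :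
    GradOp (fine n M) ((n : ℕ) : ℂ) * PcT n M ((n : ℕ) : ℂ) * (GradOp (fine n M) ((n : ℕ) : ℂ))ᴴ = Xp n M a' * (Kcomp n M a')⁻¹ * (Xp n M a')ᴴ := by
  rw [← GradOp_Pone_GradOpH_eq n M ha', Pone_eq_iso n M ha', Xp_conjTranspose, Xp]
  simp only [Matrix.mul_assoc]

/-- `Kcomp = (Q̃′G′)·(G′Q̃′ᴴ)`. [folklore] -/
theorem Kcomp_eq_gram' (a' : ℝ) : Kcomp n M a' = (Qiso n M * Gps n M a') * (Gps n M a' * (Qiso n M)ᴴ) := by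
  rw [(Kcomp_eq_iso n M (a' := a')).1]; simp only [Matrix.mul_assoc]

omit [NeZero n] hM in
/-- the telescoping of a conjugated triple product: `ABC − A′B′C′ = (A − A′)BC + A′(B − B′)C + A′B′(C − C′)`. [folklore] -/
theorem triple_sub {ι τ σ υ : Type*} [Fintype τ] [Fintype σ] (A A' : Matrix ι τ ℂ) (B B' : Matrix τ σ ℂ) (C C' : Matrix σ υ ℂ) :
    A * B * C - A' * B' * C' = (A - A') * B * C + A' * (B - B') * C + A' * B' * (C - C') := by
  simp only [Matrix.sub_mul, Matrix.mul_sub]; abel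

/-! ## §2 The factor bounds -/

/-- `BXp = √(1/γ′)` (the bound of `‖X‖`). [folklore] -/
abbrev BXp (d : ℕ) (a' : ℝ) : ℝ := Real.sqrt ((gammaPs d a')⁻¹)

/-- **`EXp = EdG·(1 + ε_Q) + √(1/γ′)·ε_Q`** (the bound of `‖cX − X‖`). [folklore] -/
def EXp (d : ℕ) (a' κ Λ : ℝ) : ℝ := EdG d a' κ Λ * (1 + epsQ κ Λ) + BXp d a' * epsQ κ Λ

/-- **`deltaK = EQG·(γ′⁻¹ + EQG) + γ′⁻¹·EQG`** (the bound of `‖cK − K‖`). [folklore] -/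
def deltaK (d : ℕ) (a' κ Λ : ℝ) : ℝ := EQG d a' κ Λ * ((gammaPs d a')⁻¹ + EQG d a' κ Λ) + (gammaPs d a')⁻¹ * EQG d a' κ Λ

/-- **`EK`**: the bound of `‖c(∂P∂ᴴ) − ∂P∂ᴴ‖` (`s = σ₀²`). [folklore] -/
def EK (d : ℕ) (a' κ Λ : ℝ) : ℝ :=
  EXp d a' κ Λ * (sigma0 d a' ^ 2 - deltaK d a' κ Λ)⁻¹ * (BXp d a' + EXp d a' κ Λ)
    + BXp d a' * ((sigma0 d a' ^ 2 - deltaK d a' κ Λ)⁻¹ * deltaK d a' κ Λ * (sigma0 d a' ^ 2)⁻¹) * (BXp d a' + EXp d a' κ Λ)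
    + BXp d a' * (sigma0 d a' ^ 2)⁻¹ * EXp d a' κ Λ

/-- `‖X‖ ≤ √(1/γ′)`. [folklore] -/
theorem opNorm_Xp_le (ha' : 0 < a') : ‖Xp n M a'‖ ≤ BXp d a' := by
  rw [Xp]
  calc _ ≤ ‖GradOp (fine n M) ((n : ℕ) : ℂ) * Gps n M a'‖ * ‖(Qiso n M)ᴴ‖ := Matrix.l2_opNorm_mul _ _
    _ ≤ Real.sqrt ((gammaPs d a')⁻¹) * 1 := by
        rw [Matrix.l2_opNorm_conjTranspose]
        exact mul_le_mul (opNorm_GradOp_mul_Gps_le n M ha') (opNorm_Qiso_le n M) (norm_nonneg _) (Real.sqrt_nonneg _)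
    _ = BXp d a' := mul_one _

omit [NeZero n] hM in
/-- `ε_Q ≥ 0` for `Λ ≥ 0`. [folklore] -/
theorem epsQ_nonneg (hΛ : 0 ≤ Λ) (κ : ℝ) : 0 ≤ epsQ κ Λ := sub_nonneg.mpr (Real.one_le_exp (by positivity))

/-- `EdG ≥ 0` (it bounds a norm). [folklore] -/
theorem EdG_nonneg (ha' : 0 < a') (hΛ : 0 ≤ Λ) (hlip : ∀ x ν, |ρ₀ (x + unitVec (fine n M) ν) - ρ₀ x| ≤ 1 / n)
    (hosc : ∀ x x', blockOf n M x = blockOf n M x' → |ρ₀ x - ρ₀ x'| ≤ Λ) (hγ : Jfree d a' κ Λ < gammaPs d a') : 0 ≤ EdG d a' κ Λ :=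
  (norm_nonneg _).trans (opNorm_conjMat_GradOp_Gps_sub_le n M ha' hΛ hlip hosc hγ)

/-- `EQG ≥ 0`. [folklore] -/
theorem EQG_nonneg (ha' : 0 < a') (hΛ : 0 ≤ Λ) (hlip : ∀ x ν, |ρ₀ (x + unitVec (fine n M) ν) - ρ₀ x| ≤ 1 / n)
    (hosc : ∀ x x', blockOf n M x = blockOf n M x' → |ρ₀ x - ρ₀ x'| ≤ Λ) (hγ : Jfree d a' κ Λ < gammaPs d a') : 0 ≤ EQG d a' κ Λ :=
  (norm_nonneg _).trans (opNorm_conjMat_Qiso_Gps_sub_le n M ha' hΛ hlip hosc hγ)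

/-- **`‖cX − X‖ ≤ EXp`** (`X = (∂G′)·Q̃′ᴴ`, product rule). [folklore] -/
theorem opNorm_conjMat_Xp_sub_le (ha' : 0 < a') (hΛ : 0 ≤ Λ) (hlip : ∀ x ν, |ρ₀ (x + unitVec (fine n M) ν) - ρ₀ x| ≤ 1 / n)
    (hosc : ∀ x x', blockOf n M x = blockOf n M x' → |ρ₀ x - ρ₀ x'| ≤ Λ) (hγ : Jfree d a' κ Λ < gammaPs d a') :
    ‖conjMat κ (bondW₀ n M ρ₀) (coarseW n M ρ₀) (Xp n M a') - Xp n M a'‖ ≤ EXp d a' κ Λ := by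
  have hQH : ‖conjMat κ ρ₀ (coarseW n M ρ₀) (Qiso n M)ᴴ - (Qiso n M)ᴴ‖ ≤ epsQ κ Λ := opNorm_conjMat_QisoH_sub_le n M κ hΛ hosc
  have hQHc : ‖conjMat κ ρ₀ (coarseW n M ρ₀) (Qiso n M)ᴴ‖ ≤ 1 + epsQ κ Λ :=
    (opNorm_conjMat_le_add κ _ _ _).trans (add_le_add (by rw [Matrix.l2_opNorm_conjTranspose]; exact opNorm_Qiso_le n M) hQH)
  rw [Xp, EXp]
  refine (opNorm_conjMat_mul_sub_le κ (bondW₀ n M ρ₀) ρ₀ (coarseW n M ρ₀) _ _).trans (add_le_add ?_ ?_)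
  · exact mul_le_mul (opNorm_conjMat_GradOp_Gps_sub_le n M ha' hΛ hlip hosc hγ) hQHc (norm_nonneg _) (EdG_nonneg n M ha' hΛ hlip hosc hγ)
  · exact mul_le_mul (opNorm_GradOp_mul_Gps_le n M ha') hQH (norm_nonneg _) (Real.sqrt_nonneg _)

omit [NeZero n] hM in
/-- `EXp(−κ) = EXp(κ)`. [folklore] -/
theorem EXp_neg (d : ℕ) (a' κ Λ : ℝ) : EXp d a' (-κ) Λ = EXp d a' κ Λ := by simp only [EXp, EdG_neg, epsQ, abs_neg]

/-- **`‖cXᴴ − Xᴴ‖ ≤ EXp`** (adjoint rule, evenness). [folklore] -/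
theorem opNorm_conjMat_XpH_sub_le (ha' : 0 < a') (hΛ : 0 ≤ Λ) (hlip : ∀ x ν, |ρ₀ (x + unitVec (fine n M) ν) - ρ₀ x| ≤ 1 / n)
    (hosc : ∀ x x', blockOf n M x = blockOf n M x' → |ρ₀ x - ρ₀ x'| ≤ Λ) (hγ : Jfree d a' κ Λ < gammaPs d a') :
    ‖conjMat κ (coarseW n M ρ₀) (bondW₀ n M ρ₀) (Xp n M a')ᴴ - (Xp n M a')ᴴ‖ ≤ EXp d a' κ Λ := by
  rw [opNorm_conjMat_conjTranspose_sub_eq, ← EXp_neg]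
  exact opNorm_conjMat_Xp_sub_le n M ha' hΛ hlip hosc (by rwa [Jfree_neg])

/-- **`‖cK − K‖ ≤ deltaK`** for `K = Kcomp = (Q̃′G′)(G′Q̃′ᴴ)`. [folklore] -/
theorem opNorm_conjMat_Kcomp_sub_le (ha' : 0 < a') (hΛ : 0 ≤ Λ) (hlip : ∀ x ν, |ρ₀ (x + unitVec (fine n M) ν) - ρ₀ x| ≤ 1 / n)
    (hosc : ∀ x x', blockOf n M x = blockOf n M x' → |ρ₀ x - ρ₀ x'| ≤ Λ) (hγ : Jfree d a' κ Λ < gammaPs d a') :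
    ‖conjMat κ (coarseW n M ρ₀) (coarseW n M ρ₀) (Kcomp n M a') - Kcomp n M a'‖ ≤ deltaK d a' κ Λ := by
  have hγ' := (gammaPs_pos (d := d) (a' := a')).1
  have hQG : ‖Qiso n M * Gps n M a'‖ ≤ (gammaPs d a')⁻¹ :=
    (Matrix.l2_opNorm_mul _ _).trans ((mul_le_mul (opNorm_Qiso_le n M) (opNorm_Gps_le n M ha') (norm_nonneg _) zero_le_one).trans (by rw [one_mul]))
  have hGQ : ‖Gps n M a' * (Qiso n M)ᴴ‖ ≤ (gammaPs d a')⁻¹ := by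
    rw [show Gps n M a' * (Qiso n M)ᴴ = (Qiso n M * Gps n M a')ᴴ by rw [Matrix.conjTranspose_mul, (Gps_isHermitian n M a').eq],
      Matrix.l2_opNorm_conjTranspose]
    exact hQG
  have h1 := opNorm_conjMat_Qiso_Gps_sub_le n M ha' hΛ hlip hosc hγ
  have h2 := opNorm_conjMat_Gps_QisoH_sub_le n M ha' hΛ hlip hosc hγ
  have hE0 := EQG_nonneg n M ha' hΛ hlip hosc hγ
  rw [Kcomp_eq_gram', deltaK]
  refine (opNorm_conjMat_mul_sub_le κ (coarseW n M ρ₀) ρ₀ (coarseW n M ρ₀) _ _).trans (add_le_add ?_ ?_)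
  · exact mul_le_mul h1 ((opNorm_conjMat_le_add κ _ _ _).trans (add_le_add hGQ h2)) (norm_nonneg _) hE0
  · exact mul_le_mul hQG h2 (norm_nonneg _) (inv_nonneg.mpr hγ'.le)

/-- `Kcomp` is `σ₀²`-coercive (`form_Kcomp_ge` in `Coercive` vocabulary). [folklore] -/
theorem coercive_Kcomp (ha' : 0 < a') : Coercive (sigma0 d a' ^ 2) (Kcomp n M a') := fun φ => form_Kcomp_ge n M ha' φ

/-! ## §3 The conjugation defect of the gauge term -/

/-- **THE GAUGE TERM HAS A SMALL CONJUGATION DEFECT**: `‖c(∂·PcT·∂ᴴ) − ∂·PcT·∂ᴴ‖ ≤ EK d a′ κ Λ` for bond weights `ρ_b = bondW₀ ρ₀` of a `1/n`-Lipschitz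
site weight with block oscillation `≤ Λ`, whenever `Jfree < γ′` and `deltaK < σ₀²` (both hold for small `|κ|`) — level-free. [folklore] -/
theorem opNorm_conjMat_gaugeTerm_sub_le (ha' : 0 < a') (hΛ : 0 ≤ Λ) (hlip : ∀ x ν, |ρ₀ (x + unitVec (fine n M) ν) - ρ₀ x| ≤ 1 / n)
    (hosc : ∀ x x', blockOf n M x = blockOf n M x' → |ρ₀ x - ρ₀ x'| ≤ Λ) (hγ : Jfree d a' κ Λ < gammaPs d a') (hδ : deltaK d a' κ Λ < sigma0 d a' ^ 2) :
    ‖conjMat κ (bondW₀ n M ρ₀) (bondW₀ n M ρ₀) (GradOp (fine n M) ((n : ℕ) : ℂ) * PcT n M ((n : ℕ) : ℂ) * (GradOp (fine n M) ((n : ℕ) : ℂ))ᴴ)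
        - GradOp (fine n M) ((n : ℕ) : ℂ) * PcT n M ((n : ℕ) : ℂ) * (GradOp (fine n M) ((n : ℕ) : ℂ))ᴴ‖ ≤ EK d a' κ Λ := by
  have hσ : 0 < sigma0 d a' ^ 2 := pow_pos (sigma0_pos (d := d) ha') 2
  set X := Xp n M a' with hX
  set K := Kcomp n M a' with hK
  set cX := conjMat κ (bondW₀ n M ρ₀) (coarseW n M ρ₀) X with hcX
  set cKi := conjMat κ (coarseW n M ρ₀) (coarseW n M ρ₀) K⁻¹ with hcKi
  set cXH := conjMat κ (coarseW n M ρ₀) (bondW₀ n M ρ₀) Xᴴ with hcXH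
  -- the pieces
  have hXn : ‖X‖ ≤ BXp d a' := opNorm_Xp_le n M ha'
  have hEX : ‖cX - X‖ ≤ EXp d a' κ Λ := opNorm_conjMat_Xp_sub_le n M ha' hΛ hlip hosc hγ
  have hEXH : ‖cXH - Xᴴ‖ ≤ EXp d a' κ Λ := opNorm_conjMat_XpH_sub_le n M ha' hΛ hlip hosc hγ
  have hEX0 : 0 ≤ EXp d a' κ Λ := (norm_nonneg _).trans hEX
  have hncXH : ‖cXH‖ ≤ BXp d a' + EXp d a' κ Λ :=
    (opNorm_conjMat_le_add κ _ _ _).trans (add_le_add (by rw [Matrix.l2_opNorm_conjTranspose]; exact hXn) hEXH)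
  have hdeltaK : ‖conjMat κ (coarseW n M ρ₀) (coarseW n M ρ₀) K - K‖ ≤ deltaK d a' κ Λ := opNorm_conjMat_Kcomp_sub_le n M ha' hΛ hlip hosc hγ
  have hδ0 : 0 ≤ deltaK d a' κ Λ := (norm_nonneg _).trans hdeltaK
  have hncKi : ‖cKi‖ ≤ (sigma0 d a' ^ 2 - deltaK d a' κ Λ)⁻¹ := by
    rw [hcKi, conjMat_inv]; exact opNorm_conjMat_inv_le (coercive_Kcomp n M ha') κ _ hdeltaK hδ
  have hcKiK : ‖cKi - K⁻¹‖ ≤ (sigma0 d a' ^ 2 - deltaK d a' κ Λ)⁻¹ * deltaK d a' κ Λ * (sigma0 d a' ^ 2)⁻¹ :=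
    opNorm_conjMat_inv_sub_le hσ (coercive_Kcomp n M ha') κ _ hdeltaK hδ
  have hKi : ‖K⁻¹‖ ≤ (sigma0 d a' ^ 2)⁻¹ := opNorm_Kcomp_inv_le n M ha'
  have hs0 : 0 ≤ (sigma0 d a' ^ 2 - deltaK d a' κ Λ)⁻¹ := inv_nonneg.mpr (by linarith)
  -- the expansion
  rw [gaugeTerm_eq_factor n M ha', ← hX, ← hK, conjMat_mul κ (bondW₀ n M ρ₀) (coarseW n M ρ₀) (bondW₀ n M ρ₀),
    conjMat_mul κ (bondW₀ n M ρ₀) (coarseW n M ρ₀) (coarseW n M ρ₀), ← hcX, ← hcKi, ← hcXH, triple_sub, EK]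
  calc _ ≤ ‖(cX - X) * cKi * cXH‖ + ‖X * (cKi - K⁻¹) * cXH‖ + ‖X * K⁻¹ * (cXH - Xᴴ)‖ :=
        (norm_add_le _ _).trans (add_le_add (norm_add_le _ _) le_rfl)
    _ ≤ EXp d a' κ Λ * (sigma0 d a' ^ 2 - deltaK d a' κ Λ)⁻¹ * (BXp d a' + EXp d a' κ Λ)
        + BXp d a' * ((sigma0 d a' ^ 2 - deltaK d a' κ Λ)⁻¹ * deltaK d a' κ Λ * (sigma0 d a' ^ 2)⁻¹) * (BXp d a' + EXp d a' κ Λ)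
        + BXp d a' * (sigma0 d a' ^ 2)⁻¹ * EXp d a' κ Λ := by
        gcongr
        · exact (Matrix.l2_opNorm_mul _ _).trans (mul_le_mul ((Matrix.l2_opNorm_mul _ _).trans (mul_le_mul hEX hncKi (norm_nonneg _) hEX0)) hncXH
            (norm_nonneg _) (mul_nonneg hEX0 hs0))
        · exact (Matrix.l2_opNorm_mul _ _).trans (mul_le_mul ((Matrix.l2_opNorm_mul _ _).trans (mul_le_mul hXn hcKiK (norm_nonneg _) (Real.sqrt_nonneg _)))
            hncXH (norm_nonneg _) (mul_nonneg (Real.sqrt_nonneg _) (by positivity)))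
        · exact (Matrix.l2_opNorm_mul _ _).trans (mul_le_mul ((Matrix.l2_opNorm_mul _ _).trans (mul_le_mul hXn hKi (norm_nonneg _) (Real.sqrt_nonneg _)))
            hEXH (norm_nonneg _) (mul_nonneg (Real.sqrt_nonneg _) (inv_nonneg.mpr hσ.le)))

end Summit.QuantumFields.BalabanUV.T4Continuum.CTGaugeTerm

end
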